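import Summits.AtomisticToContinuum.HydrodynamicLimit.Theorems.BoxDissipativeWeakStrongRelativeEnergyStabilityTimeZero
import Summits.AtomisticToContinuum.HydrodynamicLimit.Theorems.BoxDissipativeWeakStrongRelativeEnergyStabilityBalanceLaws
import Summits.AtomisticToContinuum.HydrodynamicLimit.Theorems.AnnealedZeroHorizonAnnealedWeakStrongFieldsCloseTendsto
import Literature.MathematicalPhysics.KineticTheory.HardSphereEulerProofs
import HarnessLib

/-!
# Crux `RelativeEnergyStability` (stmt-AtomisticToContinuum-17653), line `registered`:
helpers of the stub `stub_clampedRelEnergyCoercive` (S3') — from box fields to tested fields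

The pathwise read-out step of S3' (adapted from the continuous-kernel read-out
`AnnealedZeroHorizonAnnealedWeakStrongFieldsCloseTendsto` to the discontinuous BOX kernel `K_ℓ` of the route):
for a weighted empirical average `A(χ) = (N+1)⁻¹ Σ χ(xᵢ) aᵢ` (`aᵢ = 1, vᵢ, |vᵢ|²/2`) and a continuous test
function `χ` on the compact torus (`AWS.FieldsCloseTendsto.norm_wavg_sub_le` is reused for `ω`-close tests),

* `co_wavg_box_eq` — box transfer `A(χ^K) = ∫ χ(x) A(K_ℓ(x, ·)) dx`, `χ^K(y) = ∫ K_ℓ(x, y) χ(x) dx`;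
* `co_abs_sub_boxAvg_le` — `|χ − χ^K| ≤ ω` once `χ` varies by `≤ ω` at sup-distance `< ℓ/2` (unit `x`-mass and
  support of the box kernel, `LGFS.abs_integral_kernel_mul_sub_le`);
* `co_norm_field_dev_le` and its three specialisations `co_abs_density_dev_le`, `co_norm_momentum_dev_le`,
  `co_abs_energy_dev_le` (registered helper sub-goal) — each tested deviation is
  `≤ ω(1 + |∫Ē| + D) + ‖χ‖_∞ D` with `D = ∫ (|ρ̂ − ρ| + ‖m̂ − ρu‖ + |Ê − E|) dx` the `L¹(dx)` box deviation
  (velocity moments through `(N+1)⁻¹Σ|vᵢ|²/2 = ∫ Ê dx`, `bb_integral_energy`);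
* `co_tendsto_measure_of_le` — the Markov step with an almost-sure pathwise domination (no measurability of
  `D` is needed: `P(E) = ∫⁻ 𝟙_E ≤ c⁻¹ ∫⁻ ofReal D`).

References: BrezinaFeireisl2018 §3.2; Spohn1991 Part I Ch. 3; OllaVaradhanYau1993 §1.
-/

noncomputable section

namespace Summit.AtomisticToContinuum.HydrodynamicLimit.Theorems.RES

open MeasureTheory Filter Set
open scoped ENNReal Topology
open Summit.AtomisticToContinuum.HydrodynamicLimit.Theses.BoxDissipativeWeakStrong
open Literature.MathematicalPhysics.KineticTheory Literature.Analysis.FluidPDE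
open Literature.Analysis.FluidPDE.CompressibleEuler
open Literature.Analysis.FluidPDE.CompressibleEuler.EulerPhase

variable {N : ℕ} {G : Type*} [NormedAddCommGroup G] [NormedSpace ℝ G]

/-! ## Weighted empirical averages against the box kernel -/

/-- **Box transfer**: `(N+1)⁻¹ ∑ χ^K(xᵢ) aᵢ = ∫ χ(x) ((N+1)⁻¹ ∑ K_ℓ(x, xᵢ) aᵢ) dx`,
`χ^K(y) = ∫ K_ℓ(x, y) χ(x) dx`. -/
theorem co_wavg_box_eq [CompleteSpace G] (z : Config (N + 1) (Fin 3) T3) (a : Fin (N + 1) → G)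
    {χ : T3 → ℝ} (hχ : Continuous χ) {l : ℝ} (hl : 0 ≤ l) :
    ((N + 1 : ℕ) : ℝ)⁻¹ • ∑ i, (∫ x, boxKernel l x (z i).1 * χ x) • a i =
      ∫ x, χ x • (((N + 1 : ℕ) : ℝ)⁻¹ • ∑ i, boxKernel l x (z i).1 • a i) := by
  -- adapted from `AWS.FieldsCloseTendsto.wavg_mollify_eq`
  have hi : ∀ i ∈ Finset.univ, Integrable (fun x => (boxKernel l x (z i).1 * χ x) • a i) := fun i _ =>
    (bb_integrable_boxKernel_mul hl _ hχ).smul_const _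
  symm
  calc ∫ x, χ x • (((N + 1 : ℕ) : ℝ)⁻¹ • ∑ i, boxKernel l x (z i).1 • a i)
      = ∫ x, ((N + 1 : ℕ) : ℝ)⁻¹ • ∑ i, (boxKernel l x (z i).1 * χ x) • a i := by
        refine integral_congr_ae (ae_of_all _ fun x => ?_)
        dsimp only
        rw [smul_comm, Finset.smul_sum]
        congr 1
        exact Finset.sum_congr rfl fun i _ => by rw [smul_smul, mul_comm]
    _ = ((N + 1 : ℕ) : ℝ)⁻¹ • ∑ i, ∫ x, (boxKernel l x (z i).1 * χ x) • a i := by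
        rw [integral_smul, integral_finsetSum _ hi]
    _ = ((N + 1 : ℕ) : ℝ)⁻¹ • ∑ i, (∫ x, boxKernel l x (z i).1 * χ x) • a i := by
        congr 1
        exact Finset.sum_congr rfl fun i _ => integral_smul_const _ _

/-- **The box average of a test function is uniformly close to it**: `|χ(q) − ∫ K_ℓ(x,q) χ(x) dx| ≤ ω` when
`χ` varies by `≤ ω` at sup-distance `< ℓ/2` (`0 < ℓ ≤ 1`: unit `x`-mass of the kernel). -/
theorem co_abs_sub_boxAvg_le {l : ℝ} (hl : 0 < l) (hl1 : l ≤ 1) {χ : T3 → ℝ} (hχ : Continuous χ) {C ω : ℝ}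
    (hC : ∀ x, |χ x| ≤ C) (hmod : ∀ x y, dist x y < l / 2 → |χ x - χ y| ≤ ω) (q : T3) :
    |χ q - ∫ x, boxKernel l x q * χ x| ≤ ω := by
  have hcomm : (fun x => boxKernel l x q * χ x) = fun x => boxKernel l q x * χ x :=
    funext fun x => by rw [show boxKernel l x q = boxKernel l q x from EABirthS2bA.boxKernel_comm l x q]
  rw [abs_sub_comm, hcomm]
  exact LGFS.abs_integral_kernel_mul_sub_le (g := fun x => boxKernel l q x) (LGFS.measurable_boxK_right l q)
    (fun x => LGFS.boxK_nonneg hl.le q x) (fun x => LGFS.boxK_le hl.le q x) (LGFS.integral_boxK_right hl hl1 q)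
    (fun x hx => LGFS.dist_lt_of_boxK_ne_zero hl hx) hχ.measurable hC fun x hx => hmod x q hx

/-- **Pathwise deviation bound for a weighted empirical field `A(χ) = (N+1)⁻¹ ∑ χ(xᵢ) aᵢ` against box
fields**: `‖A(χ) − ∫ χ • g‖ ≤ ω (N+1)⁻¹∑‖aᵢ‖ + C ∫ ‖A(K_ℓ(x, ·)) − g(x)‖ dx` for `|χ| ≤ C` varying by `≤ ω`
at sup-distance `< ℓ/2`, `g` continuous and the box field `x ↦ A(K_ℓ(x, ·))` integrable. -/
theorem co_norm_field_dev_le [CompleteSpace G] (z : Config (N + 1) (Fin 3) T3) {A : (T3 → ℝ) → G}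
    {a : Fin (N + 1) → G} (hA : ∀ χ, A χ = ((N + 1 : ℕ) : ℝ)⁻¹ • ∑ i, χ (z i).1 • a i)
    {χ : T3 → ℝ} {g : T3 → G} {ω C l : ℝ} (hχ : Continuous χ) (hC : ∀ x, |χ x| ≤ C) (hl : 0 < l)
    (hl1 : l ≤ 1) (hmod : ∀ x y, dist x y < l / 2 → |χ x - χ y| ≤ ω) (hg : Continuous g)
    (hAi : Integrable fun x => A (boxKernel l x)) :
    ‖A χ - ∫ x, χ x • g x‖ ≤
      ω * (((N + 1 : ℕ) : ℝ)⁻¹ * ∑ i, ‖a i‖) + C * ∫ x, ‖A (boxKernel l x) - g x‖ := by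
  -- adapted from `AWS.FieldsCloseTendsto.norm_field_dev_le` / `norm_sub_integral_smul_le`
  obtain ⟨χk, hχk⟩ : ∃ χk : T3 → ℝ, χk = fun y => ∫ x, boxKernel l x y * χ x := ⟨_, rfl⟩
  have hclose : ∀ y, |χ y - χk y| ≤ ω := fun y => by
    rw [hχk]; exact co_abs_sub_boxAvg_le hl hl1 hχ hC hmod y
  have h1 : ‖A χ - A χk‖ ≤ ω * (((N + 1 : ℕ) : ℝ)⁻¹ * ∑ i, ‖a i‖) := by
    rw [hA, hA]; exact AWS.FieldsCloseTendsto.norm_wavg_sub_le z a hclose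
  have h2 : A χk = ∫ x, χ x • A (boxKernel l x) := by
    simp_rw [hA, hχk]; exact co_wavg_box_eq z a hχ hl.le
  have hi1 : Integrable fun x => χ x • A (boxKernel l x) :=
    hAi.bdd_smul C hχ.aestronglyMeasurable (ae_of_all _ fun x => by rw [Real.norm_eq_abs]; exact hC x)
  have hgi : Integrable g := integrable_of_continuous_T3 hg
  have hi2 : Integrable fun x => χ x • g x := integrable_of_continuous_T3 (hχ.smul hg)
  have h3 : A χk - ∫ x, χ x • g x = ∫ x, χ x • (A (boxKernel l x) - g x) := by
    rw [h2, ← integral_sub hi1 hi2]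
    exact integral_congr_ae (ae_of_all _ fun x => (smul_sub _ _ _).symm)
  have h4 : ‖∫ x, χ x • (A (boxKernel l x) - g x)‖ ≤ C * ∫ x, ‖A (boxKernel l x) - g x‖ :=
    calc ‖∫ x, χ x • (A (boxKernel l x) - g x)‖ ≤ ∫ x, ‖χ x • (A (boxKernel l x) - g x)‖ :=
          norm_integral_le_integral_norm _
      _ ≤ ∫ x, C * ‖A (boxKernel l x) - g x‖ := by
          refine integral_mono_of_nonneg (ae_of_all _ fun _ => norm_nonneg _)
            ((hAi.sub hgi).norm.const_mul C) (ae_of_all _ fun x => ?_)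
          dsimp only
          rw [norm_smul, Real.norm_eq_abs]
          exact mul_le_mul_of_nonneg_right (hC x) (norm_nonneg _)
      _ = C * ∫ x, ‖A (boxKernel l x) - g x‖ := integral_const_mul _ _
  calc ‖A χ - ∫ x, χ x • g x‖ = ‖(A χ - A χk) + (A χk - ∫ x, χ x • g x)‖ := by congr 1; abel
    _ ≤ ‖A χ - A χk‖ + ‖A χk - ∫ x, χ x • g x‖ := norm_add_le _ _
    _ ≤ _ := add_le_add h1 (h3 ▸ h4)

/-! ## The box deviation controls the components and the kinetic energy -/

section Deviations

variable (z : Config (N + 1) (Fin 3) T3) {χ r ϑ : T3 → ℝ} {w : T3 → V3} {ω C l : ℝ}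

/-- The three components of `D = ∫ (|ρ̂ − ρ| + ‖m̂ − ρu‖ + |Ê − E|) dx` are bounded by `D`. -/
theorem co_integral_comp_le (hl : 0 ≤ l) (hr : Continuous r) (hw : Continuous w) (hϑ : Continuous ϑ) :
    (∫ x, ‖empiricalDensityField z (boxKernel l x) - r x‖ ≤
        ∫ x, (|empiricalDensityField z (boxKernel l x) - r x| +
          ‖empiricalMomentumField z (boxKernel l x) - r x • w x‖ +
          |empiricalEnergyField z (boxKernel l x) - totalEnergyDensity (r x) (w x) (ϑ x)|)) ∧
      (∫ x, ‖empiricalMomentumField z (boxKernel l x) - r x • w x‖ ≤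
        ∫ x, (|empiricalDensityField z (boxKernel l x) - r x| +
          ‖empiricalMomentumField z (boxKernel l x) - r x • w x‖ +
          |empiricalEnergyField z (boxKernel l x) - totalEnergyDensity (r x) (w x) (ϑ x)|)) ∧
      (∫ x, ‖empiricalEnergyField z (boxKernel l x) - totalEnergyDensity (r x) (w x) (ϑ x)‖ ≤
        ∫ x, (|empiricalDensityField z (boxKernel l x) - r x| +
          ‖empiricalMomentumField z (boxKernel l x) - r x • w x‖ +
          |empiricalEnergyField z (boxKernel l x) - totalEnergyDensity (r x) (w x) (ϑ x)|)) := by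
  have hE : Continuous fun x => totalEnergyDensity (r x) (w x) (ϑ x) := by
    unfold totalEnergyDensity; fun_prop
  have hD := tz_integrable_dev z hl (f₂ := fun x => r x • w x) hr (hr.smul hw) hE
  obtain ⟨h1, h2, h3⟩ := EABirthS2bA.integrable_fields hl z
  refine ⟨integral_mono (h1.sub (integrable_of_continuous_T3 hr)).norm hD fun x => ?_,
    integral_mono (h2.sub (integrable_of_continuous_T3 (hr.smul hw))).norm hD fun x => ?_,
    integral_mono (h3.sub (integrable_of_continuous_T3 hE)).norm hD fun x => ?_⟩
  all_goals simp only [Real.norm_eq_abs]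
  · exact le_add_of_le_of_nonneg (le_add_of_nonneg_right (norm_nonneg _)) (abs_nonneg _)
  · exact le_add_of_le_of_nonneg (le_add_of_nonneg_left (abs_nonneg _)) (abs_nonneg _)
  · exact le_add_of_nonneg_left (add_nonneg (abs_nonneg _) (norm_nonneg _))

/-- **Kinetic energy**: `(N+1)⁻¹ ∑ ‖vᵢ‖²/2 = ∫ Ê dx ≤ |∫ Ē| + D` for `0 < ℓ ≤ 1`. -/
theorem co_kinetic_le (hl : 0 < l) (hl1 : l ≤ 1) (hr : Continuous r) (hw : Continuous w)
    (hϑ : Continuous ϑ) :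
    ((N + 1 : ℕ) : ℝ)⁻¹ * ∑ i, ‖(z i).2‖ ^ 2 / 2 ≤ |∫ x, totalEnergyDensity (r x) (w x) (ϑ x)| +
      ∫ x, (|empiricalDensityField z (boxKernel l x) - r x| +
        ‖empiricalMomentumField z (boxKernel l x) - r x • w x‖ +
        |empiricalEnergyField z (boxKernel l x) - totalEnergyDensity (r x) (w x) (ϑ x)|) := by
  have hE : Continuous fun x => totalEnergyDensity (r x) (w x) (ϑ x) := by
    unfold totalEnergyDensity; fun_prop
  have hV : ((N + 1 : ℕ) : ℝ)⁻¹ * ∑ i, ‖(z i).2‖ ^ 2 / 2 = ∫ x, empiricalEnergyField z (boxKernel l x) := by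
    rw [bb_integral_energy z hl hl1, configEnergy, Finset.mul_sum, Finset.mul_sum, Finset.mul_sum]
    push_cast
    exact Finset.sum_congr rfl fun i _ => by ring
  have h3 := (EABirthS2bA.integrable_fields hl.le z).2.2
  have hEi : Integrable fun x => totalEnergyDensity (r x) (w x) (ϑ x) := integrable_of_continuous_T3 hE
  rw [hV]
  calc ∫ x, empiricalEnergyField z (boxKernel l x)
      = ∫ x, (totalEnergyDensity (r x) (w x) (ϑ x) +
          (empiricalEnergyField z (boxKernel l x) - totalEnergyDensity (r x) (w x) (ϑ x))) :=
        integral_congr_ae (ae_of_all _ fun x => by ring)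
    _ = (∫ x, totalEnergyDensity (r x) (w x) (ϑ x)) +
          ∫ x, (empiricalEnergyField z (boxKernel l x) - totalEnergyDensity (r x) (w x) (ϑ x)) :=
        integral_add hEi (h3.sub hEi)
    _ ≤ _ := add_le_add (le_abs_self _) ((le_abs_self _).trans
          (abs_integral_le_integral_abs.trans (co_integral_comp_le z hl.le hr hw hϑ).2.2))

/-- **Density**: `|⟨ρ_N, χ⟩ − ∫ χ ρ| ≤ ω + ‖χ‖_∞ D`. -/
theorem co_abs_density_dev_le (hχ : Continuous χ) (hC0 : 0 ≤ C) (hC : ∀ x, |χ x| ≤ C) (hl : 0 < l)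
    (hl1 : l ≤ 1) (hmod : ∀ x y, dist x y < l / 2 → |χ x - χ y| ≤ ω) (hr : Continuous r)
    (hw : Continuous w) (hϑ : Continuous ϑ) :
    |empiricalDensityField z χ - ∫ x, χ x * r x| ≤
      ω + C * ∫ x, (|empiricalDensityField z (boxKernel l x) - r x| +
        ‖empiricalMomentumField z (boxKernel l x) - r x • w x‖ +
        |empiricalEnergyField z (boxKernel l x) - totalEnergyDensity (r x) (w x) (ϑ x)|) := by
  have h := co_norm_field_dev_le z (A := fun χ => empiricalDensityField z χ) (a := fun _ => (1 : ℝ))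
    (fun χ => by simp only [empiricalDensityField_eq_sum, smul_eq_mul, mul_one]) hχ hC hl hl1 hmod hr
    (EABirthS2bA.integrable_fields hl.le z).1
  have h1 : ((N + 1 : ℕ) : ℝ)⁻¹ * ∑ _i : Fin (N + 1), ‖(1 : ℝ)‖ = 1 := by
    rw [Finset.sum_const, Finset.card_univ, Fintype.card_fin, norm_one, nsmul_eq_mul, mul_one,
      inv_mul_cancel₀ (by positivity)]
  rw [h1, mul_one] at h
  exact h.trans (add_le_add le_rfl (mul_le_mul_of_nonneg_left (co_integral_comp_le z hl.le hr hw hϑ).1 hC0))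

/-- **Momentum**: `‖⟨m_N, χ⟩ − ∫ (χρ) • u‖ ≤ ω (1/2 + |∫ Ē| + D) + ‖χ‖_∞ D`. -/
theorem co_norm_momentum_dev_le (hχ : Continuous χ) (hC0 : 0 ≤ C) (hC : ∀ x, |χ x| ≤ C) (hl : 0 < l)
    (hl1 : l ≤ 1) (hω0 : 0 ≤ ω) (hmod : ∀ x y, dist x y < l / 2 → |χ x - χ y| ≤ ω) (hr : Continuous r)
    (hw : Continuous w) (hϑ : Continuous ϑ) :
    ‖empiricalMomentumField z χ - ∫ x, (χ x * r x) • w x‖ ≤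
      ω * (1 / 2 + |∫ x, totalEnergyDensity (r x) (w x) (ϑ x)| +
          ∫ x, (|empiricalDensityField z (boxKernel l x) - r x| +
            ‖empiricalMomentumField z (boxKernel l x) - r x • w x‖ +
            |empiricalEnergyField z (boxKernel l x) - totalEnergyDensity (r x) (w x) (ϑ x)|)) +
        C * ∫ x, (|empiricalDensityField z (boxKernel l x) - r x| +
          ‖empiricalMomentumField z (boxKernel l x) - r x • w x‖ +
          |empiricalEnergyField z (boxKernel l x) - totalEnergyDensity (r x) (w x) (ϑ x)|) := by
  have h := co_norm_field_dev_le z (A := fun χ => empiricalMomentumField z χ) (a := fun i => (z i).2)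
    (fun χ => empiricalMomentumField_eq_sum z χ) hχ hC hl hl1 hmod (hr.smul hw)
    (EABirthS2bA.integrable_fields hl.le z).2.1
  have hv : ((N + 1 : ℕ) : ℝ)⁻¹ * ∑ i, ‖(z i).2‖ ≤
      1 / 2 + ((N + 1 : ℕ) : ℝ)⁻¹ * ∑ i, ‖(z i).2‖ ^ 2 / 2 := by
    have hn : ((N + 1 : ℕ) : ℝ)⁻¹ * ∑ _i : Fin (N + 1), (1 / 2 : ℝ) = 1 / 2 := by
      rw [Finset.sum_const, Finset.card_univ, Fintype.card_fin, nsmul_eq_mul, ← mul_assoc,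
        inv_mul_cancel₀ (by positivity), one_mul]
    rw [← hn, ← mul_add, ← Finset.sum_add_distrib]
    refine mul_le_mul_of_nonneg_left (Finset.sum_le_sum fun i _ => ?_) (by positivity)
    nlinarith [sq_nonneg (‖(z i).2‖ - 1), norm_nonneg (z i).2]
  have hK := co_kinetic_le z hl hl1 hr hw hϑ
  calc ‖empiricalMomentumField z χ - ∫ x, (χ x * r x) • w x‖
      = ‖empiricalMomentumField z χ - ∫ x, χ x • r x • w x‖ := by simp_rw [mul_smul]
    _ ≤ _ := h
    _ ≤ _ := add_le_add (mul_le_mul_of_nonneg_left (hv.trans (by linarith)) hω0)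
        (mul_le_mul_of_nonneg_left (co_integral_comp_le z hl.le hr hw hϑ).2.1 hC0)

/-- **Energy** (registered helper sub-goal): `|⟨E_N, χ⟩ − ∫ χ Ē| ≤ ω (|∫ Ē| + D) + ‖χ‖_∞ D`. -/
theorem co_abs_energy_dev_le {N : ℕ} (z : Config (N + 1) (Fin 3) T3) {χ r ϑ : T3 → ℝ} {w : T3 → V3} {ω C l : ℝ} (hχ : Continuous χ) (hC0 : 0 ≤ C) (hC : ∀ x, |χ x| ≤ C) (hl : 0 < l) (hl1 : l ≤ 1) (hω0 : 0 ≤ ω) (hmod : ∀ x y, dist x y < l / 2 → |χ x - χ y| ≤ ω) (hr : Continuous r) (hw : Continuous w) (hϑ : Continuous ϑ) : |empiricalEnergyField z χ - ∫ x, χ x * totalEnergyDensity (r x) (w x) (ϑ x)| ≤ ω * (|∫ x, totalEnergyDensity (r x) (w x) (ϑ x)| + ∫ x, (|empiricalDensityField z (boxKernel l x) - r x| + ‖empiricalMomentumField z (boxKernel l x) - r x • w x‖ + |empiricalEnergyField z (boxKernel l x) - totalEnergyDensity (r x) (w x) (ϑ x)|)) + C * ∫ x, (|empiricalDensityField z (boxKernel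 l x) - r x| + ‖empiricalMomentumField z (boxKernel l x) - r x • w x‖ + |empiricalEnergyField z (boxKernel l x) - totalEnergyDensity (r x) (w x) (ϑ x)|) := by
  have hE : Continuous fun x => totalEnergyDensity (r x) (w x) (ϑ x) := by
    unfold totalEnergyDensity; fun_prop
  have h := co_norm_field_dev_le z (A := fun χ => empiricalEnergyField z χ) (a := fun i => ‖(z i).2‖ ^ 2 / 2)
    (fun χ => by simp only [empiricalEnergyField_eq_sum, smul_eq_mul]) hχ hC hl hl1 hmod hE
    (EABirthS2bA.integrable_fields hl.le z).2.2
  have he : ((N + 1 : ℕ) : ℝ)⁻¹ * ∑ i, ‖‖(z i).2‖ ^ 2 / 2‖ = ((N + 1 : ℕ) : ℝ)⁻¹ * ∑ i, ‖(z i).2‖ ^ 2 / 2 := by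
    congr 1
    exact Finset.sum_congr rfl fun i _ => by rw [Real.norm_eq_abs, abs_of_nonneg (by positivity)]
  rw [he] at h
  exact h.trans (add_le_add (mul_le_mul_of_nonneg_left (co_kinetic_le z hl hl1 hr hw hϑ) hω0)
    (mul_le_mul_of_nonneg_left (co_integral_comp_le z hl.le hr hw hϑ).2.2 hC0))

end Deviations

/-! ## The Markov step with an almost-sure domination -/

/-- **Markov with an a.s. pathwise domination**: if on the measurable events `E_N`, almost surely and
eventually in `N`, `c ≤ D_N` for one constant `c > 0`, and `E ofReal(D_N) → 0`, then `P_N(E_N) → 0`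
(`P(E) = ∫⁻ 𝟙_E ≤ c⁻¹ ∫⁻ ofReal D`; no measurability of `D` is used). -/
theorem co_tendsto_measure_of_le {Ω : ℕ → Type*} [∀ n, MeasurableSpace (Ω n)] (P : (n : ℕ) → Measure (Ω n))
    {E : (n : ℕ) → Set (Ω n)} {D : (n : ℕ) → Ω n → ℝ} {c : ℝ} (hc : 0 < c)
    (hE : ∀ n, MeasurableSet (E n))
    (hD : Tendsto (fun n => ∫⁻ z, ENNReal.ofReal (D n z) ∂P n) atTop (𝓝 0))
    (hdom : ∀ᶠ n in atTop, ∀ᵐ z ∂P n, z ∈ E n → c ≤ D n z) :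
    Tendsto (fun n => P n (E n)) atTop (𝓝 0) := by
  have hlim : Tendsto (fun n => (ENNReal.ofReal c)⁻¹ * ∫⁻ z, ENNReal.ofReal (D n z) ∂P n) atTop (𝓝 0) := by
    have h := ENNReal.Tendsto.const_mul hD (a := (ENNReal.ofReal c)⁻¹)
      (Or.inr (ENNReal.inv_ne_top.2 (ENNReal.ofReal_pos.2 hc).ne'))
    rwa [mul_zero] at h
  refine tendsto_of_tendsto_of_tendsto_of_le_of_le' tendsto_const_nhds hlim
    (Eventually.of_forall fun n => bot_le) ?_
  filter_upwards [hdom] with n hn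
  have hc' : ENNReal.ofReal c ≠ 0 := (ENNReal.ofReal_pos.2 hc).ne'
  calc P n (E n) = ∫⁻ z, (E n).indicator 1 z ∂P n := (lintegral_indicator_one (hE n)).symm
    _ ≤ ∫⁻ z, (ENNReal.ofReal c)⁻¹ * ENNReal.ofReal (D n z) ∂P n := by
        refine lintegral_mono_ae (hn.mono fun z hz => ?_)
        by_cases hzE : z ∈ E n
        · rw [indicator_of_mem hzE, Pi.one_apply, ← ENNReal.inv_mul_cancel hc' ENNReal.ofReal_ne_top]
          exact mul_le_mul' le_rfl (ENNReal.ofReal_le_ofReal (hz hzE))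
        · rw [indicator_of_notMem hzE]; exact bot_le
    _ = (ENNReal.ofReal c)⁻¹ * ∫⁻ z, ENNReal.ofReal (D n z) ∂P n :=
        lintegral_const_mul' _ _ (ENNReal.inv_ne_top.2 hc')

end Summit.AtomisticToContinuum.HydrodynamicLimit.Theorems.RES

end
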